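import Literature.MathematicalPhysics.QuantumLattice.HubbardNNNHoppingEnergyDensityRegionBounds
import HarnessLib

/-!
# One-band HULL-ATLAS law: density ROWS at finitely many `(t', U)` points combine, by joint concavity, into a density row at any point of their convex hull

`Literature.MathematicalPhysics.QuantumLattice.ThermodynamicLimit` (the `energyDensityTT'` API). The tree has the two-point form
(`energyDensityTT'_ge_convexComb`, from `concaveOn_energyDensityTT'_tPrime_U`); the HULL-ATLAS device of hubbard-box-p2 (README-BOXWORD §HULL-ATLAS) needs
the FINITE form: certified rows `aᵢ + bᵢ·n ≤ e(t, sᵢ, Uᵢ, n)` (`n ∈ [n₁, n₂]`; kernel cluster rows `acf2x2_*_row_*` / `kacf2x3_*_row_*` / `kwac2x3_*`, free-fermion tangent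
rows …) at library points `(sᵢ, Uᵢ)` with `Uᵢ ≥ 0`, and weights `λᵢ ≥ 0`, `Σλᵢ = 1`, give the row `(Σλᵢaᵢ) + (Σλᵢbᵢ)·n ≤ e(t, Σλᵢsᵢ, ΣλᵢUᵢ, n)` on the same density
segment — exactly the «corner row» input of the affine box-word device `energyDensityTT'_affineFloor_Icc₃_of_cornerRows`. With an exact rational LP choosing `λ`, any new
one-band `(U, t', n)` box inside the convex hull of the certified `(t', U)` library gets a hypothesis-free word with NO new kernel certificate.
Proved here: the finite Jensen inequality (§1) and the row form (§2). [cite: Israel1979, Thm. I.3.4] [cite: Rockafellar1970, Thm 32.2]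
-/

noncomputable section

namespace Literature.MathematicalPhysics.QuantumLattice

namespace ThermodynamicLimit

open Finset Set
open scoped BigOperators

/-! ## §1 Finite Jensen in `(t', U)` at fixed density -/

/-- **Finite Jensen for the `t–t'` Hubbard energy density in `(t', U)`**: at fixed `t` and `0 ≤ n < 2`, floors `mᵢ ≤ e(t, sᵢ, Uᵢ, n)` at points with `Uᵢ ≥ 0`
and weights `λᵢ ≥ 0`, `Σλᵢ = 1` give `Σλᵢmᵢ ≤ e(t, Σλᵢsᵢ, ΣλᵢUᵢ, n)` (concavity `concaveOn_energyDensityTT'_tPrime_U`). [cite: Israel1979, Thm. I.3.4] [cite: Rockafellar1970, Thm 32.2] -/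
theorem energyDensityTT'_ge_sum_convexComb (t : ℝ) {n : ℝ} (hn0 : 0 ≤ n) (hn2 : n < 2) {ι : Type*} [Fintype ι]
    (w : ι → ℝ) (s U m : ι → ℝ) (hw0 : ∀ i, 0 ≤ w i) (hw1 : ∑ i, w i = 1) (hU : ∀ i, 0 ≤ U i)
    (hm : ∀ i, m i ≤ energyDensityTT' t (s i) (U i) n) :
    ∑ i, w i * m i ≤ energyDensityTT' t (∑ i, w i * s i) (∑ i, w i * U i) n := by
  have hJ := (concaveOn_energyDensityTT'_tPrime_U t hn0 hn2).le_map_sum (t := Finset.univ) (w := w) (p := fun i => ((s i, U i) : ℝ × ℝ))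
    (fun i _ => hw0 i) hw1 (fun i _ => by simpa using hU i)
  have h1 : (∑ i, w i • ((s i, U i) : ℝ × ℝ)) = ((∑ i, w i * s i, ∑ i, w i * U i) : ℝ × ℝ) := by
    ext <;> simp [Prod.fst_sum, Prod.snd_sum, smul_eq_mul]
  rw [h1] at hJ
  refine le_trans (Finset.sum_le_sum fun i _ => ?_) hJ
  rw [smul_eq_mul]
  exact mul_le_mul_of_nonneg_left (hm i) (hw0 i)

/-! ## §2 The row form (affine in the density on a segment) -/

/-- **HULL ROW**: rows `aᵢ + bᵢ·m ≤ e(t, sᵢ, Uᵢ, m)` for all `m ∈ [n₁, n₂]` (`0 ≤ n₁`, `n₂ < 2`, `Uᵢ ≥ 0`) and weights `λᵢ ≥ 0`, `Σλᵢ = 1` give the row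
`(Σλᵢaᵢ) + (Σλᵢbᵢ)·m ≤ e(t, Σλᵢsᵢ, ΣλᵢUᵢ, m)` for all `m ∈ [n₁, n₂]` — a «corner row» for `energyDensityTT'_affineFloor_Icc₃_of_cornerRows` at any point of the
convex hull of the certified `(t', U)` library, with NO new certificate. [cite: Israel1979, Thm. I.3.4] [cite: Rockafellar1970, Thm 32.2] -/
theorem energyDensityTT'_hullRow_of_rows (t : ℝ) {n₁ n₂ : ℝ} (hn0 : 0 ≤ n₁) (hn2 : n₂ < 2) {ι : Type*} [Fintype ι]
    (w : ι → ℝ) (s U a b : ι → ℝ) (hw0 : ∀ i, 0 ≤ w i) (hw1 : ∑ i, w i = 1) (hU : ∀ i, 0 ≤ U i)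
    (hrow : ∀ i, ∀ m ∈ Set.Icc n₁ n₂, a i + b i * m ≤ energyDensityTT' t (s i) (U i) m) :
    ∀ m ∈ Set.Icc n₁ n₂, (∑ i, w i * a i) + (∑ i, w i * b i) * m ≤ energyDensityTT' t (∑ i, w i * s i) (∑ i, w i * U i) m := by
  intro m hm
  have h := energyDensityTT'_ge_sum_convexComb t (hn0.trans hm.1) (lt_of_le_of_lt hm.2 hn2) w s U (fun i => a i + b i * m) hw0 hw1 hU
    (fun i => hrow i m hm)
  refine le_trans (le_of_eq ?_) h
  rw [Finset.sum_mul, ← Finset.sum_add_distrib]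
  exact Finset.sum_congr rfl fun i _ => by ring

/-- **HULL ROW, bundled hull point**: the same with the hull point `(s⋆, U⋆)` and the row coefficients `(A, B)` named by equations (the shape a generator emits:
`Σλᵢsᵢ = s⋆`, `ΣλᵢUᵢ = U⋆`, `Σλᵢaᵢ = A`, `Σλᵢbᵢ = B` closed by `norm_num`). [cite: Israel1979, Thm. I.3.4] -/
theorem energyDensityTT'_hullRow_of_rows_eq (t : ℝ) {n₁ n₂ : ℝ} (hn0 : 0 ≤ n₁) (hn2 : n₂ < 2) {ι : Type*} [Fintype ι]
    (w : ι → ℝ) (s U a b : ι → ℝ) (hw0 : ∀ i, 0 ≤ w i) (hw1 : ∑ i, w i = 1) (hU : ∀ i, 0 ≤ U i)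
    (hrow : ∀ i, ∀ m ∈ Set.Icc n₁ n₂, a i + b i * m ≤ energyDensityTT' t (s i) (U i) m)
    {sStar UStar A B : ℝ} (hs : ∑ i, w i * s i = sStar) (hUe : ∑ i, w i * U i = UStar) (hA : ∑ i, w i * a i = A) (hB : ∑ i, w i * b i = B) :
    ∀ m ∈ Set.Icc n₁ n₂, A + B * m ≤ energyDensityTT' t sStar UStar m := by
  rw [← hs, ← hUe, ← hA, ← hB]
  exact energyDensityTT'_hullRow_of_rows t hn0 hn2 w s U a b hw0 hw1 hU hrow

end ThermodynamicLimit

end Literature.MathematicalPhysics.QuantumLattice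

end
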